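import Literature.MathematicalPhysics.QuantumLattice.DWaveOrderParameterQuasiAverageState
import HarnessLib

/-!
# Translation-invariant states: the pair amplitude FLOORS the box-averaged pair two-point function
# (`‖ω(P₀)‖² ≤ Re N⁻⁴ Σ_{x,y∈[0,N)²} ω(P_x⋆ P_y)` at every `N`), hence Koma–Tasaki's quasi-average
# ground state of the `t–t'` Hubbard pencil has `d`-wave ODLRO `≥ (m*)²`

Topic `Literature/MathematicalPhysics/QuantumLattice` (namespace = path). Seat `hubbard-cq-p4`
(cell `pub/hubbard-cq`, row "finite-h Kennedy–Lieb–Shastry / Koma–Tasaki dictionary lemmas the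
transplant / dual lenses need"), transplant-1 DICTIONARY v2 §10 (BN-T4 (a)): the ONE row of the
sourced-order dictionary that runs RESPONSE ⇒ LONG-RANGE ORDER, in the infinite-volume class.
Everything is PROVED; no definition, no named fact, zero compute.

## What is proved (carrier `InfVolFermionState`, `P_x = localPairAt S g x`, `pairCorr ω S g x y = ω(P_x⋆ P_y)`)

* `InfVolFermionState.norm_expect_sq_le_re_expect_conjTranspose_mul_self` — **Cauchy–Schwarz for
  states**: `‖ω(A)‖² ≤ Re ω(A⋆A)` (Bratteli–Robinson I, Lemma 2.3.10 (b) with `B = 𝟙`); real-part form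
  `re_expect_sq_le_re_expect_conjTranspose_mul_self`.
* `InfVolFermionState.shift_expect_localPairAt`, `IsTranslationInvariant.expect_localPairAt_eq` —
  translation covariance of the local singlet pairs: `(ω∘τ_v)(P_x) = ω(P_{x+v})`, so a
  translation-invariant state has ONE pair amplitude `ω(P_x) = ω(P_0)`.
* `InfVolFermionState.sum_sum_pairCorr_eq_expect` — the double box sum IS one expectation:
  `Σ_{x,y∈B} ω(P_x⋆ P_y) = ω(Δ_B⋆ Δ_B)`, `Δ_B = Σ_{x∈B} P_x` (all pairs embedded in one region), hence
  its real part is `≥ 0` (`re_sum_sum_pairCorr_nonneg`) — for EVERY state.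
* **`IsTranslationInvariant.norm_expect_localPairAt_sq_mul_le_re_sum_sum_pairCorr`** — for EVERY
  translation-invariant state and every `N`:
  `N⁴ · ‖ω(P_0)‖² ≤ Re Σ_{x,y∈[0,N)²} ω(P_x⋆ P_y)`, i.e. (`…_le_re_boxAverage_pairCorr`, `N ≠ 0`)
  `‖ω(P_0)‖² ≤ Re (N⁻⁴ Σ_{x,y∈[0,N)²} ω(P_x⋆ P_y))`.  Proof: `ω(Δ_B) = N² ω(P_0)` by translation
  invariance, then Cauchy–Schwarz.  This is the finite-`N`, ergodicity-free EASY HALF of the tree's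
  named fact `InfVolFermionState.ergodic_pairCorr_boxAverage` (Bratteli–Robinson I Thm. 4.3.17: for
  ERGODIC `ω` the box average CONVERGES to `|ω(P_0)|²`); here `≥` at every `N`, for all
  translation-invariant states, no convergence claimed.
* `d`-wave corollaries (`S = {0} ∪ unitSteps`, `g = dWaveFormFactor`, `P₀^d`,
  `m* = dWaveOrderParameterTT' t' U μ`; "ground state" = mean-energy minimiser of
  `hubbardTTPrimeMuInteraction 1 t' U μ`, range `1`, exactly as in
  `DWaveOrderParameterQuasiAverageState.lean`):
  `IsTranslationInvariant.re_expect_localPairAt_sq_le_re_boxAverage_dWavePairCorr` (every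
  translation-invariant state: `(Re ω(P₀^d))² ≤ Re N⁻⁴ Σ ω(P_x⋆P_y)`);
  **`exists_isMeanEnergyMinimiser_dWaveOrderParameterTT'_sq_le_re_boxAverage_dWavePairCorr`** — the
  quasi-average state of Koma–Tasaki (`Re ω(P₀^d) = m*`, hubbard-cq-p5's
  `exists_isMeanEnergyMinimiser_re_expect_localPairAt_eq_dWaveOrderParameterTT'`) is a
  translation-invariant infinite-volume ground state with `d`-wave OFF-DIAGONAL LONG-RANGE ORDER
  `≥ (m*)²` UNIFORMLY IN THE BOX: `(m*)² ≤ Re N⁻⁴ Σ_{x,y∈[0,N)²} ω(P_x⋆ P_y)` for every `N ≥ 1`;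
  **`exists_isMeanEnergyMinimiser_odlro_of_hasDWaveOrderTT'`** — `HasDWaveOrderTT' t' U μ` (positive
  Koma–Tasaki order parameter, i.e. a positive pinning-field RESPONSE in the iterated limit
  `h → 0⁺` after `L → ∞`) ⟹ an infinite-volume translation-invariant ground state with a strictly
  positive ODLRO floor exists (`t' = 0` twin `exists_isMeanEnergyMinimiser_odlro_of_hasDWaveOrder`).

## Honest placement (cell `hubbard-cq`, rows PC-a / census (24), (27), (31))

Direction RESPONSE ⇒ LRO, but in the INFINITE-VOLUME class only (T5): the state carrying the order is
the weak-⋆ limit `h → 0⁺` AFTER `L → ∞`; nothing is said about the symmetric torus ground states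
`ψ_L` of the summit statement (that passage is transplant-1's `[U] ∧ [BN7]`, obst-1's BN7, and stays
open), and nothing here is a floor INSTRUMENT (the hypothesis `m* > 0` is itself the uncertifiable
object).  The state produced here still BREAKS the gauge symmetry (`Re ω(P₀^d) = m* > 0`); its gauge
average — a SYMMETRIC ground state with the same ODLRO floor and zero pair amplitude — needs the
`U(1)` gauge action on `InfVolFermionState` (sequel file).  The converse direction (LRO of symmetric
states ⇒ `m* > 0`) is Koma–Tasaki 1993 Thm. 7.3 / the tree's `le_dWaveOrderParameter_of_pairLRO`
family (finite volume) and is NOT used here.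

## References
* O. Bratteli, D. W. Robinson, *Operator Algebras and Quantum Statistical Mechanics 1*, 2nd ed. (1987),
  Lemma 2.3.10 (Cauchy–Schwarz for states), Thm. 4.3.17 / Prop. 4.3.4 (ergodic box averages).
  [cite: BratteliRobinsonI1987, Lemma 2.3.10 and Thm. 4.3.17]
* G. L. Sewell, J. Math. Phys. 11 (1970) 1868, §4 (ODLRO of states of the quasi-local algebra).
  [cite: Sewell1970, §4]
* T. Koma, H. Tasaki, J. Stat. Phys. 76 (1994) 745–803, §1 (order parameters `m*`, quasi-averages;
  symmetry breaking versus long-range order in infinite volume). [cite: KomaTasaki1994, §1]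
-/

noncomputable section

namespace Literature.MathematicalPhysics.QuantumLattice

open _root_.Matrix Finset HubbardWave0 Literature.Probability.LatticeModels _root_.Filter Set
open scoped _root_.Topology ComplexOrder

namespace InfVolFermionState

/-! ### Cauchy–Schwarz for states -/

section CauchySchwarz

variable {d : ℕ} (ω : InfVolFermionState d)

/-- **Cauchy–Schwarz for an infinite-volume state**: `‖ω(A)‖² ≤ Re ω(A⋆A)` for every local
observable `A ∈ 𝔄_Λ` (positivity of `ω((A − ω(A)𝟙)⋆(A − ω(A)𝟙))` and `ω(A⋆) = conj ω(A)`).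
[cite: BratteliRobinsonI1987, Lemma 2.3.10 (b)] -/
theorem norm_expect_sq_le_re_expect_conjTranspose_mul_self (Λ : Finset (Site d)) (A : FermionOp Λ) :
    ‖ω.expect Λ A‖ ^ 2 ≤ (ω.expect Λ (Aᴴ * A)).re := by
  set c : ℂ := ω.expect Λ A with hc
  have hexp : (A - c • (1 : FermionOp Λ))ᴴ * (A - c • (1 : FermionOp Λ)) =
      Aᴴ * A - c • Aᴴ - (star c) • A + (star c * c) • (1 : FermionOp Λ) := by
    rw [Matrix.conjTranspose_sub, Matrix.conjTranspose_smul, Matrix.conjTranspose_one, sub_mul,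
      mul_sub, mul_sub, Matrix.mul_smul, Matrix.mul_one, Matrix.smul_mul, Matrix.one_mul,
      Matrix.smul_mul, Matrix.one_mul, smul_smul]
    abel
  have h := ω.expect_nonneg Λ (A - c • (1 : FermionOp Λ))
  rw [hexp, map_add, map_sub, map_sub, map_smul, map_smul, map_smul, ω.expect_one,
    ω.expect_conjTranspose, ← hc, smul_eq_mul, smul_eq_mul, smul_eq_mul, mul_one] at h
  have hre := (Complex.nonneg_iff.1 h).1
  have hcc : (c * star c).re = ‖c‖ ^ 2 := by
    rw [Complex.star_def, Complex.mul_conj, Complex.ofReal_re, Complex.normSq_eq_norm_sq]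
  have hcc' : (star c * c).re = ‖c‖ ^ 2 := by
    rw [mul_comm]; exact hcc
  simp only [Complex.add_re, Complex.sub_re, hcc, hcc'] at hre
  linarith

/-- Real-part form of Cauchy–Schwarz: `(Re ω(A))² ≤ Re ω(A⋆A)`. [cite: BratteliRobinsonI1987, Lemma 2.3.10 (b)] -/
theorem re_expect_sq_le_re_expect_conjTranspose_mul_self (Λ : Finset (Site d)) (A : FermionOp Λ) :
    (ω.expect Λ A).re ^ 2 ≤ (ω.expect Λ (Aᴴ * A)).re := by
  refine le_trans ?_ (ω.norm_expect_sq_le_re_expect_conjTranspose_mul_self Λ A)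
  have hab := abs_le.1 (Complex.abs_re_le_norm (ω.expect Λ A))
  exact sq_le_sq' hab.1 hab.2

end CauchySchwarz

/-! ### Translation covariance of the local singlet pairs -/

section Pairs

/-- **`(ω ∘ τ_v)(P_x) = ω(P_{x+v})`** for the local singlet pairs `P_x = localPairAt S g x`
(`Γ(τ_v) P_x = P_{x+v}` up to isotony, `fermionEmbed_shiftEmb_localPairAt`).
[cite: ArakiMoriya2003, §4.1 Def. 4.3 and eq. (4.11)] -/
theorem shift_expect_localPairAt (ω : InfVolFermionState 2) (v : Site 2) (S : Finset (Site 2))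
    (g : Site 2 → ℝ) (x : Site 2) :
    (ω.shift v).expect (pairRegion S x) (localPairAt S g x) =
      ω.expect (pairRegion S (x + v)) (localPairAt S g (x + v)) := by
  rw [shift_expect, fermionEmbed_shiftEmb_localPairAt, ω.compatible]

/-- **A translation-invariant state has one pair amplitude**: `ω(P_x) = ω(P_0)` for every `x ∈ ℤ²`.
[cite: Sewell1970, §4] -/
theorem IsTranslationInvariant.expect_localPairAt_eq {ω : InfVolFermionState 2}
    (hω : ω.IsTranslationInvariant) (S : Finset (Site 2)) (g : Site 2 → ℝ) (x : Site 2) :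
    ω.expect (pairRegion S x) (localPairAt S g x) = ω.expect (pairRegion S 0) (localPairAt S g 0) := by
  have h := shift_expect_localPairAt ω x S g 0
  rw [hω x, zero_add] at h
  exact h.symm

/-- **The double sum of the pair two-point function over a finite set `B ⊆ ℤ²` is ONE expectation**:
`Σ_{x,y∈B} ω(P_x⋆ P_y) = ω(Δ_B⋆ Δ_B)` with `Δ_B = Σ_{x∈B} Γ(pairRegion S x ⊆ Λ) P_x ∈ 𝔄_Λ` for any
region `Λ` containing all the pair regions. [cite: Sewell1970, §4] -/
theorem sum_sum_pairCorr_eq_expect (ω : InfVolFermionState 2) (S : Finset (Site 2)) (g : Site 2 → ℝ)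
    (B : Finset (Site 2)) {Λ : Finset (Site 2)} (hΛ : ∀ x ∈ B, pairRegion S x ⊆ Λ) :
    ∑ x ∈ B, ∑ y ∈ B, ω.pairCorr S g x y =
      ω.expect Λ ((∑ x ∈ B.attach, fermionEmbed (PolySite.incl (hΛ x.1 x.2)) (localPairAt S g x.1))ᴴ *
        ∑ x ∈ B.attach, fermionEmbed (PolySite.incl (hΛ x.1 x.2)) (localPairAt S g x.1)) := by
  rw [Matrix.conjTranspose_sum, Finset.sum_mul, map_sum]
  conv_lhs => rw [← Finset.sum_attach B]
  refine Finset.sum_congr rfl fun x _ => ?_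
  rw [Finset.mul_sum, map_sum]
  conv_lhs => rw [← Finset.sum_attach B]
  refine Finset.sum_congr rfl fun y _ => ?_
  rw [pairCorr, ← fermionEmbed_conjTranspose, ω.corr_eq_expect_of_subset (hΛ x.1 x.2) (hΛ y.1 y.2)]

/-- **`Re Σ_{x,y∈B} ω(P_x⋆ P_y) ≥ 0`** for every state and every finite `B` (it is `ω(Δ_B⋆ Δ_B)`).
[cite: Sewell1970, §4] -/
theorem re_sum_sum_pairCorr_nonneg (ω : InfVolFermionState 2) (S : Finset (Site 2)) (g : Site 2 → ℝ)
    (B : Finset (Site 2)) : 0 ≤ (∑ x ∈ B, ∑ y ∈ B, ω.pairCorr S g x y).re := by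
  have hΛ : ∀ x ∈ B, pairRegion S x ⊆ B.biUnion (pairRegion S) := fun x hx =>
    Finset.subset_biUnion_of_mem (pairRegion S) hx
  rw [ω.sum_sum_pairCorr_eq_expect S g B hΛ]
  exact (Complex.nonneg_iff.1 (ω.expect_nonneg _ _)).1

/-- **For a translation-invariant state `Σ_{x∈B} ω(Γ P_x) = |B| · ω(P_0)`** (each embedded pair has
the expectation of `P_0`). [cite: Sewell1970, §4] -/
theorem IsTranslationInvariant.expect_sum_fermionEmbed_localPairAt {ω : InfVolFermionState 2}
    (hω : ω.IsTranslationInvariant) (S : Finset (Site 2)) (g : Site 2 → ℝ) (B : Finset (Site 2))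
    {Λ : Finset (Site 2)} (hΛ : ∀ x ∈ B, pairRegion S x ⊆ Λ) :
    ω.expect Λ (∑ x ∈ B.attach, fermionEmbed (PolySite.incl (hΛ x.1 x.2)) (localPairAt S g x.1)) =
      (B.card : ℂ) * ω.expect (pairRegion S 0) (localPairAt S g 0) := by
  rw [map_sum]
  have h : ∀ x ∈ B.attach, ω.expect Λ (fermionEmbed (PolySite.incl (hΛ x.1 x.2)) (localPairAt S g x.1)) =
      ω.expect (pairRegion S 0) (localPairAt S g 0) := fun x _ => by
    rw [ω.compatible, hω.expect_localPairAt_eq]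
  rw [Finset.sum_congr rfl h, Finset.sum_const, Finset.card_attach, nsmul_eq_mul]

/-- **THE PAIR AMPLITUDE FLOORS THE BOX SUMS OF THE PAIR TWO-POINT FUNCTION** (every
translation-invariant infinite-volume state, every `N`):
`N⁴ · ‖ω(P_0)‖² ≤ Re Σ_{x,y∈[0,N)²} ω(P_x⋆ P_y)` — Cauchy–Schwarz `|ω(Δ_B)|² ≤ ω(Δ_B⋆Δ_B)` for
`Δ_B = Σ_{x∈[0,N)²} P_x`, `ω(Δ_B) = N² ω(P_0)`.  The finite-`N`, ergodicity-free half of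
Bratteli–Robinson I Thm. 4.3.17 (tree: named fact `ergodic_pairCorr_boxAverage` gives EQUALITY in the
limit for ergodic states). [cite: BratteliRobinsonI1987, Thm. 4.3.17 and Lemma 2.3.10] -/
theorem IsTranslationInvariant.norm_expect_localPairAt_sq_mul_le_re_sum_sum_pairCorr
    {ω : InfVolFermionState 2} (hω : ω.IsTranslationInvariant) (S : Finset (Site 2)) (g : Site 2 → ℝ)
    (N : ℕ) :
    (N : ℝ) ^ 4 * ‖ω.expect (pairRegion S 0) (localPairAt S g 0)‖ ^ 2 ≤
      (∑ x ∈ halfOpenBox 2 N, ∑ y ∈ halfOpenBox 2 N, ω.pairCorr S g x y).re := by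
  set B : Finset (Site 2) := halfOpenBox 2 N with hB
  have hΛ : ∀ x ∈ B, pairRegion S x ⊆ B.biUnion (pairRegion S) := fun x hx =>
    Finset.subset_biUnion_of_mem (pairRegion S) hx
  have hcard : (B.card : ℂ) = (N : ℂ) ^ 2 := by
    rw [hB, card_halfOpenBox]; push_cast; ring
  have hCS := ω.norm_expect_sq_le_re_expect_conjTranspose_mul_self _
    (∑ x ∈ B.attach, fermionEmbed (PolySite.incl (hΛ x.1 x.2)) (localPairAt S g x.1))
  rw [← ω.sum_sum_pairCorr_eq_expect S g B hΛ, hω.expect_sum_fermionEmbed_localPairAt S g B hΛ, hcard,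
    norm_mul, norm_pow, Complex.norm_natCast, mul_pow, ← pow_mul] at hCS
  simpa using hCS

/-- Box-AVERAGE form (`N ≠ 0`): **`‖ω(P_0)‖² ≤ Re (N⁻⁴ Σ_{x,y∈[0,N)²} ω(P_x⋆ P_y))`** for every
translation-invariant state — in the normalisation of `ergodic_pairCorr_boxAverage` /
`not_isErgodic_of_odlro`. [cite: BratteliRobinsonI1987, Thm. 4.3.17 and Lemma 2.3.10] -/
theorem IsTranslationInvariant.norm_expect_localPairAt_sq_le_re_boxAverage_pairCorr
    {ω : InfVolFermionState 2} (hω : ω.IsTranslationInvariant) (S : Finset (Site 2)) (g : Site 2 → ℝ)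
    {N : ℕ} (hN : N ≠ 0) :
    ‖ω.expect (pairRegion S 0) (localPairAt S g 0)‖ ^ 2 ≤
      (((N : ℂ) ^ 4)⁻¹ * ∑ x ∈ halfOpenBox 2 N, ∑ y ∈ halfOpenBox 2 N, ω.pairCorr S g x y).re := by
  have h := hω.norm_expect_localPairAt_sq_mul_le_re_sum_sum_pairCorr S g N
  have hN' : (0 : ℝ) < (N : ℝ) ^ 4 := by positivity
  have hcast : ((N : ℂ) ^ 4)⁻¹ = ((((N : ℝ) ^ 4)⁻¹ : ℝ) : ℂ) := by push_cast; ring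
  rw [hcast, Complex.re_ofReal_mul, le_inv_mul_iff₀ hN']
  exact h

end Pairs

end InfVolFermionState

/-! ### The `d`-wave pencil: Koma–Tasaki's quasi-average ground state has ODLRO `≥ (m*)²` -/

section DWave

open InfVolFermionState

/-- **Every translation-invariant state: `(Re ω(P₀^d))² ≤ Re N⁻⁴ Σ_{x,y∈[0,N)²} ω(P_x^d⋆ P_y^d)`**
(`N ≠ 0`; `P_x^d` the local `d_{x²−y²}` singlet pair, `dWavePairCorr`). [cite: Sewell1970, §4] -/
theorem InfVolFermionState.IsTranslationInvariant.re_expect_localPairAt_sq_le_re_boxAverage_dWavePairCorr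
    {ω : InfVolFermionState 2} (hω : ω.IsTranslationInvariant) {N : ℕ} (hN : N ≠ 0) :
    (ω.expect (pairRegion (insert (0 : Site 2) unitSteps) 0)
        (localPairAt (insert 0 unitSteps) dWaveFormFactor 0)).re ^ 2 ≤
      (((N : ℂ) ^ 4)⁻¹ * ∑ x ∈ halfOpenBox 2 N, ∑ y ∈ halfOpenBox 2 N, ω.dWavePairCorr x y).re := by
  refine le_trans ?_ (hω.norm_expect_localPairAt_sq_le_re_boxAverage_pairCorr _ _ hN)
  have hab := abs_le.1 (Complex.abs_re_le_norm (ω.expect (pairRegion (insert (0 : Site 2) unitSteps) 0)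
    (localPairAt (insert 0 unitSteps) dWaveFormFactor 0)))
  exact sq_le_sq' hab.1 hab.2

variable (t' U μ : ℝ)

/-- **KOMA–TASAKI'S QUASI-AVERAGE GROUND STATE HAS `d`-WAVE ODLRO `≥ (m*)²`, UNIFORMLY IN THE BOX.**
Some translation-invariant infinite-volume ground state `ω` of the grand-canonical `t–t'` Hubbard
interaction (mean-energy minimiser of `hubbardTTPrimeMuInteraction 1 t' U μ`) has pair amplitude
`Re ω(P₀^d) = m* = dWaveOrderParameterTT' t' U μ` (hubbard-cq-p5's quasi-average state) AND
`(m*)² ≤ Re N⁻⁴ Σ_{x,y∈[0,N)²} ω(P_x^d⋆ P_y^d)` for every `N ≥ 1`.  Direction RESPONSE ⇒ LRO in the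
infinite-volume class; the state breaks the gauge symmetry. [cite: KomaTasaki1994, §1] -/
theorem exists_isMeanEnergyMinimiser_dWaveOrderParameterTT'_sq_le_re_boxAverage_dWavePairCorr :
    ∃ ω : InfVolFermionState 2, ω.IsMeanEnergyMinimiser (hubbardTTPrimeMuInteraction 1 t' U μ) 1 ∧
      (ω.expect (pairRegion (insert (0 : Site 2) unitSteps) 0)
        (localPairAt (insert 0 unitSteps) dWaveFormFactor 0)).re = dWaveOrderParameterTT' t' U μ ∧
      ∀ N : ℕ, N ≠ 0 → dWaveOrderParameterTT' t' U μ ^ 2 ≤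
        (((N : ℂ) ^ 4)⁻¹ * ∑ x ∈ halfOpenBox 2 N, ∑ y ∈ halfOpenBox 2 N, ω.dWavePairCorr x y).re := by
  obtain ⟨ω, hω, hωe⟩ := exists_isMeanEnergyMinimiser_re_expect_localPairAt_eq_dWaveOrderParameterTT' t' U μ
  refine ⟨ω, hω, hωe, fun N hN => ?_⟩
  rw [← hωe]
  exact hω.1.re_expect_localPairAt_sq_le_re_boxAverage_dWavePairCorr hN

/-- **`d`-WAVE ORDER PARAMETER `> 0` ⟹ AN INFINITE-VOLUME GROUND STATE WITH `d`-WAVE ODLRO EXISTS**: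
`HasDWaveOrderTT' t' U μ` implies that some translation-invariant mean-energy minimiser `ω` of
`hubbardTTPrimeMuInteraction 1 t' U μ` has a strictly positive, `N`-uniform floor
`c = (m*)² > 0` under its box-averaged `d`-wave pair two-point function:
`c ≤ Re N⁻⁴ Σ_{x,y∈[0,N)²} ω(P_x^d⋆ P_y^d)` for all `N ≥ 1`. [cite: KomaTasaki1994, §1] -/
theorem exists_isMeanEnergyMinimiser_odlro_of_hasDWaveOrderTT' {t' U μ : ℝ} (h : HasDWaveOrderTT' t' U μ) :
    ∃ ω : InfVolFermionState 2, ω.IsMeanEnergyMinimiser (hubbardTTPrimeMuInteraction 1 t' U μ) 1 ∧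
      ∃ c : ℝ, 0 < c ∧ ∀ N : ℕ, N ≠ 0 →
        c ≤ (((N : ℂ) ^ 4)⁻¹ * ∑ x ∈ halfOpenBox 2 N, ∑ y ∈ halfOpenBox 2 N, ω.dWavePairCorr x y).re := by
  obtain ⟨ω, hω, -, hlro⟩ :=
    exists_isMeanEnergyMinimiser_dWaveOrderParameterTT'_sq_le_re_boxAverage_dWavePairCorr t' U μ
  exact ⟨ω, hω, dWaveOrderParameterTT' t' U μ ^ 2, pow_pos h 2, hlro⟩

/-- **`t' = 0`**: `HasDWaveOrder U μ` implies that some translation-invariant mean-energy minimiser of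
`hubbardTTPrimeMuInteraction 1 0 U μ` (the grand-canonical pure Hubbard interaction) has a strictly
positive `N`-uniform ODLRO floor. [cite: KomaTasaki1994, §1] -/
theorem exists_isMeanEnergyMinimiser_odlro_of_hasDWaveOrder {U μ : ℝ} (h : HasDWaveOrder U μ) :
    ∃ ω : InfVolFermionState 2, ω.IsMeanEnergyMinimiser (hubbardTTPrimeMuInteraction 1 0 U μ) 1 ∧
      ∃ c : ℝ, 0 < c ∧ ∀ N : ℕ, N ≠ 0 →
        c ≤ (((N : ℂ) ^ 4)⁻¹ * ∑ x ∈ halfOpenBox 2 N, ∑ y ∈ halfOpenBox 2 N, ω.dWavePairCorr x y).re :=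
  exists_isMeanEnergyMinimiser_odlro_of_hasDWaveOrderTT' ((hasDWaveOrderTT'_zero_iff U μ).2 h)

end DWave

end Literature.MathematicalPhysics.QuantumLattice

end
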